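import Literature.MathematicalPhysics.QuantumFieldTheory.Balaban1983to89.T4GeometricLedger
import Literature.MathematicalPhysics.QuantumFieldTheory.Balaban1983to89.B16StoppingRule

/-!
# `Balaban1983to89.T4EpochHorizon` — THE PRINTED HORIZON «K ≦ n₀ − j + R_j» OF LEMMA Y ON THE MODEL
(cell `pub-balaban`, node U5; record `t4/T4-EST-U5E-rem.md` §4, L5 and step (3) (unit `b2b-balaban-pv25`); journal
CLAIM T4-U5.E-REM-HORIZON-K* 2026-08-19T06:28:07Z, unit `b2b-balaban-pv25` gen 8 — NEW leaf module over this
lineage's `…T4GeometricLedger` (p184102) and over `…B16StoppingRule` (p181842, unit `b2b-balaban-b02` gen 9, used BY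
NAME only); modifies nothing)

CITATION HEADER (lean-in-tree rule 2026-08-18).  Source under audit: T. Bałaban, *Large field renormalization. II.
Localization, exponentiation, and bounds for the 𝐑 operation*, Commun. Math. Phys. **122**, 355–392 (1989)
[Balaban1989LargeFieldII] (cell paper B16; held `paper:balaban1989-cmp122-large-field-ii`, journal page = PDF page
+ 354), pp. 384–385: the definition of the number `K` of a large-field domain `Z` created at scale `j` (p. 384 [PDF 30]:
*"the number K is the smallest positive integer having the property that the domain S^K(Z), considered as a domain in
the lattice of the scale L^{−(j+K)}, satisfies the conditions (i), (ii), with N = R_j"*) and the horizon sentence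
(p. 385 [PDF 31] ll. 3–5: *"doing at most R_j further steps we obtain a domain satisfying both conditions (i), (ii).
Thus K ≦ n₀ − j + R_j"*), both quoted VERBATIM from the docstrings of `…B16StoppingRule` (whose typist read the x2
renders `b2b-balaban-ref1/pages/1989-cmp122-large-field-II/…-p030-x2.png` / `…-p031-x2.png`); conditions (i), (ii) are
those of [Balaban1989LargeFieldI] p. 177 as typed there (`CondI`, `CondII`, `StopAt`).  The paper is a manuscript UNDER
ADJUDICATION by the audit cell `pub-balaban`: NOTHING printed in it is asserted here.  Every `theorem` below is
[folklore]: finite combinatorics on `ℤᵈ` and real arithmetic over the EXISTING definitions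
`T4GeometricLedger.{GeoLedger, GeoLedger.Geometric, GeoLedger.toLedger, GeoLedger.toLedger₂, GeoLedger.base}`,
`T4EpochSize.{coverProfile, modelC}`, `T4BankAgeYoung.epochAllowance`, `B16StoppingRule.StopAt`,
`B16SProfile.{Siter, ratio, Qprod, DropCtl}`, `B13ScaleTransfer.{Pt, FaceConnected, closureIdx}`, `TreeLength.treeLen`,
proved without `sorry` and without new axioms, using BY NAME `TreeLengthDichotomy.exists_threshold_printed`,
`B16StoppingRule.{stopAt_threshold, le_of_stopAt}`, `T4EpochSize.{coverProfile_of_le, lastIndex_le_one_add_logb}` and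
`T4GeometricLedger.GeoLedger.lifetime_lt_of_geometric`.

WHAT THIS FILE IS.  `…T4GeometricLedger.GeoLedger.lifetime_lt_of_geometric` (Lemma Y of the record end to end on a
geometric genealogy ledger) keeps, besides the S-side credits, ONE located printed input per epoch: the binder
`hlen : ∀ i ≤ E, ∃ k, (k = 0 ∨ 0 < coverProfile L (expo (base i)) (steps (base i)) (dom (base i)) k) ∧
steps (base i) ≤ k + R i` — the epoch of the base lineage lasts at most `R i` steps beyond an index at which the cover
of its base still has positive linear size; this is the horizon sentence «Thus K ≦ n₀ − j + R_j» of p. 385 (record §4,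
L5 / step (3), LOCATION).  Unit `b2b-balaban-b02` typed the stopping rule of p. 384 in the ℤᵈ index model
(`…B16StoppingRule`: `StopAt Nsz N Clean X K` = `K > 0`, condition (i) with `Nsz` cubes per side for `X K`, condition
(ii) with memory `N` and a per-step cleanliness predicate `Clean` — «no new large field regions were created», a
PARAMETER, not modelled) and PROVED that the stopping property holds `N` steps after any threshold index `i₀` past which
the covers have linear size `< 1` (`stopAt_threshold`, from `condI_64_of_lt_one`: past the threshold every iterate fits
in a cube of `64` cube indices per side), inside the drop-control horizon and under p. 384's standing assumption
*"under the assumption that no large fields are created in these steps"* (`Clean` on `[1, m]`).  THIS FILE composes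
that theorem with the threshold index of `…TreeLengthDichotomy.exists_threshold_printed` and DISCHARGES `hlen`:

* §1 (one epoch, `horizon_nat` / `horizon`): for a non-empty face-connected base `Z ⊂ ℤᵈ`, `L ≥ 3`, exponents `σ`
  with `DropCtl σ m` on the horizon `m`, `Nsz ≥ 64`, `N ≥ 1`, `Clean` holding on `[1, m]`, and an epoch length
  `len ≤ m` obeying the STOPPING READING `hstop : ∀ K ≤ m, StopAt Nsz N Clean (S^{·}Z) K → len ≤ K` (the epoch does
  not outlast an index, within its horizon, at which its domain has the stopping property — the model reading of the
  DEFINITION of `K` on p. 384: the epoch of `Z` IS the `K` steps `S(Z), …, S^K(Z)`, fewer if an event merges it first):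
  `∃ k, (k = 0 ∨ 0 < coverProfile L σ m Z k) ∧ len ≤ k + N` — LITERALLY the shape of `hlen` (with `R := N`).  Proof:
  the threshold `i₀ ≤ m` has `i₀ = 0` or a cover of positive size at `i₀`, and covers of size `0 < 1` after; if
  `i₀ + N ≤ m` the stopping property holds at `i₀ + N` (`stopAt_threshold`), so `len ≤ i₀ + N`; else
  `len ≤ m < i₀ + N`.  No `Nat.find`, no decidability instance is needed (b02's `find_stopAt_le` bounds print's least
  `K`; an epoch length below any stopping index is a fortiori below `i₀ + N`).  Closed form (`horizon_logb`, `L ≥ 4`):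
  with a size ceiling `treeLen Z ≤ G`, `G ≥ 1`, the epoch length is `≤ 1 + log₂G + N`
  (`T4EpochSize.lastIndex_le_one_add_logb`) — print's «n₀ − j ≤ log_L(…) + 1» plus «R_j».
* §2 (the sub-history, `lifetime_lt_of_geometric_stopping`): `GeoLedger.lifetime_lt_of_geometric` with `hlen`, `hR`,
  `hRmax` REPLACED by per-epoch memories `N i ≥ 1` bounded by `R_max` (print: `N = R_j` of the epoch's creation scale,
  `R_max` their maximum over the sub-history), per-epoch cleanliness predicates holding on the epochs' horizons, and the
  stopping reading for the base lineages `base i`, `i ≤ E` (horizon = the epoch's own step count `steps (base i)`,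
  exponents `expo (base i)`, base `dom (base i)`): `Σ_{i ≤ E} steps (base i) < A·epochAllowance d (modelC d) R_max A`.
* §3 non-vacuity (`d = 1`): §1 on the one-cube base with `m = N = len = 1` (the stopping reading discharged by
  `le_of_stopAt`), and §2 APPLIED end to end to `T4GeometricLedger.geoEx` (its booked mass `Dtot₂ = 4` evaluated).
* §4 [v1.1, APPEND-ONLY — the v1 declarations of §1–§3 are byte-identical]: the FLOW form and THE LINK (Y3) of Lemma Y
  (`T4GenealogyLifetime.lifetime_lt_flow_of_ledger` / `lifetime_lt_youngWindow_of_ledger`) composed the same way on the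
  doubled booking of a `Geometric` `GeoLedger` — cover profiles for `hint` / `hhalf` (`coverProfile_binders`), §1's
  `horizon` for `hlen` with the memory of epoch `i` BEING its (2.5) window `N i = R (s i) ≥ 1` (`one_le_of_isRj`):
  `lifetime_lt_flow_of_geometric_stopping`, `lifetime_lt_youngWindow_of_geometric_stopping`; non-vacuity of the flow
  form on `geoEx` with the flat one-scale flow (`isRj_one`).

WHAT IS NOT CLAIMED.  (i) That the expansion's large-field history inhabits `Clean`, or which of b02's two readings of
(ii) (inclusive `StopAt`, used here, print's count; exclusive `StopAt'`, one step more — cell `DIVERGENCE.md` D-b02g9.4)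
is the construction's: with the exclusive reading §1 holds with `N + 1` in place of `N` (not typed here).  (ii) The
STOPPING READING itself — that a printed epoch (p. 386, cases (i)/(ii) of the inductive description) runs for at most the
stopping index of its START domain along the epoch's OWN exponents: on the model the epoch's domain at step `n` is
`Siter (ratio L (expo ℓ)) n (dom ℓ)` (`GeoLedger.cur`), exactly the orbit `StopAt` inspects, so the reading is the
definition of `K` transported to the ledger; for print it is part of the standing identification «a printed sub-history
is a `Geometric` `GeoLedger`» (`…T4GeometricLedger` header (iii); record §6, Q20).  (iii) The S-side credits
(`hDD`, `hce`, `hp`, `hP5`, `hb`, `hbA`; record §3 S1 / §6 [analysis]) and the model constants (`modelC d = 10·126^d`,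
`4·14^d`, `Nsz ≥ 64` for print's `100`) are untouched; NOT summit progress; NOT continuum, NOT Clay.
-/

namespace Literature.MathematicalPhysics.QuantumFieldTheory.Balaban1983to89.T4EpochHorizon

open Literature.MathematicalPhysics.QuantumFieldTheory.Balaban1983to89
open Literature.MathematicalPhysics.QuantumFieldTheory.Balaban1983to89.B13ScaleTransfer
open Literature.MathematicalPhysics.QuantumFieldTheory.Balaban1983to89.TreeLength
open Literature.MathematicalPhysics.QuantumFieldTheory.Balaban1983to89.B16SProfile
open Literature.MathematicalPhysics.QuantumFieldTheory.Balaban1983to89.TreeLengthDichotomy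
open Literature.MathematicalPhysics.QuantumFieldTheory.Balaban1983to89.B16StoppingRule
open Finset

noncomputable section

variable {d : ℕ}

/-! ## §1 The horizon of one epoch -/

section Epoch

/-- THE THRESHOLD INDEX IN THE PROFILE'S TERMS: on the horizon `[0, m]` there is an index `i₀` which is `0` or carries a
cover of positive linear size (`0 < coverProfile L σ m Z i₀`), and past which every cover has linear size `< 1`
(`TreeLengthDichotomy.exists_threshold_printed`, restated). [folklore] -/
theorem exists_threshold_coverProfile {L : ℕ} (hL : 0 < L) (σ : ℕ → ℕ) (m : ℕ) {Z : Finset (Pt d)}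
    (hZ : Z.Nonempty) (hZc : FaceConnected Z) :
    ∃ i₀, i₀ ≤ m ∧ (i₀ = 0 ∨ 0 < T4EpochSize.coverProfile L σ m Z i₀) ∧
      ∀ i, i₀ < i → i ≤ m → treeLen (closureIdx (Qprod (ratio L σ) i) Z) < 1 := by
  obtain ⟨i₀, hi₀, hA, hB⟩ := exists_threshold_printed hL σ m hZ hZc
  refine ⟨i₀, hi₀, ?_, fun i h1 h2 => by rw [hB i h1 h2]; exact zero_lt_one⟩
  rcases Nat.eq_zero_or_pos i₀ with h0 | hp
  · exact Or.inl h0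
  · right
    rw [T4EpochSize.coverProfile_of_le Z hi₀]
    exact hA i₀ hp le_rfl

/-- **THE PRINTED HORIZON ON THE MODEL** (p. 385 ll. 3–5, «doing at most R_j further steps we obtain a domain satisfying
both conditions (i), (ii). Thus K ≦ n₀ − j + R_j», LOCATION — nothing printed is asserted): an epoch length `len ≤ m`
that does not outlast any index `K ≤ m` with the stopping property `StopAt Nsz N Clean (S^{·}Z) K` (the STOPPING
READING) is at most `i₀ + N` for the threshold index `i₀` — which is `0` or carries a cover of positive size — given
`L ≥ 3`, the drop control on `[0, m]`, `Nsz ≥ 64`, `N ≥ 1` and cleanliness on `[1, m]`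
(`B16StoppingRule.stopAt_threshold` when `i₀ + N ≤ m`; else `len ≤ m < i₀ + N`). [folklore] -/
theorem horizon_nat {L : ℕ} (hL : 3 ≤ L) {σ : ℕ → ℕ} {m : ℕ} (h : DropCtl σ m) {Z : Finset (Pt d)}
    (hZ : Z.Nonempty) (hZc : FaceConnected Z) {Nsz N : ℕ} (hNsz : 64 ≤ Nsz) (hN : 1 ≤ N) (Clean : ℕ → Prop)
    (hclean : ∀ l, 1 ≤ l → l ≤ m → Clean l) {len : ℕ} (hlm : len ≤ m)
    (hstop : ∀ K, K ≤ m → StopAt Nsz N Clean (fun i => Siter (ratio L σ) i Z) K → len ≤ K) :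
    ∃ k : ℕ, (k = 0 ∨ 0 < T4EpochSize.coverProfile L σ m Z k) ∧ len ≤ k + N := by
  obtain ⟨i₀, _, hk, hB⟩ := exists_threshold_coverProfile (by omega : 0 < L) σ m hZ hZc
  refine ⟨i₀, hk, ?_⟩
  by_cases hroom : i₀ + N ≤ m
  · exact hstop _ hroom (stopAt_threshold hNsz hN hL h hZ hZc i₀ hB Clean hclean hroom)
  · omega

/-- The same in the REAL-VALUED SHAPE of the binder `hlen` of `T4BankAgeYoung.lifetime_lt` /
`T4GeometricLedger.GeoLedger.lifetime_lt_of_geometric` (window `R := N`). [folklore] -/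
theorem horizon {L : ℕ} (hL : 3 ≤ L) {σ : ℕ → ℕ} {m : ℕ} (h : DropCtl σ m) {Z : Finset (Pt d)}
    (hZ : Z.Nonempty) (hZc : FaceConnected Z) {Nsz N : ℕ} (hNsz : 64 ≤ Nsz) (hN : 1 ≤ N) (Clean : ℕ → Prop)
    (hclean : ∀ l, 1 ≤ l → l ≤ m → Clean l) {len : ℕ} (hlm : len ≤ m)
    (hstop : ∀ K, K ≤ m → StopAt Nsz N Clean (fun i => Siter (ratio L σ) i Z) K → len ≤ K) :
    ∃ k : ℕ, (k = 0 ∨ 0 < T4EpochSize.coverProfile L σ m Z k) ∧ (len : ℝ) ≤ k + (N : ℝ) := by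
  obtain ⟨k, hk, hle⟩ := horizon_nat hL h hZ hZc hNsz hN Clean hclean hlm hstop
  exact ⟨k, hk, by exact_mod_cast hle⟩

/-- CLOSED FORM («n₀ − j ≤ 1 + log₂G» of step (3) plus «R_j»): under a size ceiling `treeLen Z ≤ G`, `G ≥ 1`, and
`L ≥ 4`, such an epoch length is `≤ 1 + log₂G + N` (`T4EpochSize.lastIndex_le_one_add_logb` at the index of
`horizon_nat`). [folklore] -/
theorem horizon_logb {L : ℕ} (hL : 4 ≤ L) {σ : ℕ → ℕ} {m : ℕ} (h : DropCtl σ m) {Z : Finset (Pt d)}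
    (hZ : Z.Nonempty) (hZc : FaceConnected Z) {G : ℝ} (hG : 1 ≤ G) (hZG : treeLen Z ≤ G) {Nsz N : ℕ}
    (hNsz : 64 ≤ Nsz) (hN : 1 ≤ N) (Clean : ℕ → Prop) (hclean : ∀ l, 1 ≤ l → l ≤ m → Clean l) {len : ℕ}
    (hlm : len ≤ m) (hstop : ∀ K, K ≤ m → StopAt Nsz N Clean (fun i => Siter (ratio L σ) i Z) K → len ≤ K) :
    (len : ℝ) ≤ 1 + Real.logb 2 G + N := by
  obtain ⟨i₀, hi₀, hk, hB⟩ := exists_threshold_coverProfile (by omega : 0 < L) σ m hZ hZc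
  have hle : len ≤ i₀ + N := by
    by_cases hroom : i₀ + N ≤ m
    · exact hstop _ hroom (stopAt_threshold hNsz hN (by omega) h hZ hZc i₀ hB Clean hclean hroom)
    · omega
  have hpos : i₀ = 0 ∨ 0 < treeLen (closureIdx (Qprod (ratio L σ) i₀) Z) := by
    rcases hk with h0 | hp
    · exact Or.inl h0
    · right; rwa [T4EpochSize.coverProfile_of_le Z hi₀] at hp
  have h1 : (i₀ : ℝ) ≤ 1 + Real.logb 2 G := T4EpochSize.lastIndex_le_one_add_logb hL h hZ hZc hG hZG hi₀ hpos
  have h2 : (len : ℝ) ≤ i₀ + N := by exact_mod_cast hle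
  linarith

end Epoch

/-! ## §2 Lemma Y on a geometric genealogy ledger with the printed horizon discharged -/

section SubHistory

open T4GeometricLedger

variable {κ ι : Type*} [DecidableEq κ] [DecidableEq ι]

/-- **LEMMA Y END TO END ON A GEOMETRIC GENEALOGY LEDGER, THE HORIZON BINDER DISCHARGED**
(`T4GeometricLedger.GeoLedger.lifetime_lt_of_geometric` ∘ `horizon`).  For a `Geometric` geometric ledger whose creation
lineage is founded in epoch `0` and whose events consume alive lineages, under the S-side credits (`hDD`, `hce`, `hp`,
`hP5`, `hb`, `hbA` — UNCHANGED), per-epoch memories `N i ≥ 1` bounded by `R_max` (print: `N = R_j` at the creation scale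
of epoch `i`'s base), a size parameter `Nsz ≥ 64` (print: `100`), per-epoch cleanliness predicates holding on the
epochs' horizons (p. 384's standing assumption) and the STOPPING READING for the base lineages (epoch `i` does not
outlast an index within its horizon at which `S^{·}(dom (base i))` has the stopping property): the total lifetime obeys
`Σ_{i ≤ E} steps (base i) < A·epochAllowance d (modelC d) R_max A`. [folklore] -/
theorem lifetime_lt_of_geometric_stopping (G : GeoLedger d κ ι) (hG : G.Geometric) (h0 : G.base₀ ∈ G.founded 0)
    (hc : ∀ e, e < G.E → G.consumed e ⊆ G.toLedger.alive e) (hd : 1 ≤ d)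
    {D A : ℕ} (hDD : G.toLedger₂.Dtot ≤ (D : ℝ))
    {ce cs p₀ b : ℝ} (hce : 0 < ce) (hp : 0 < p₀) (hP5 : ce ≤ cs * p₀)
    (hb : ce * p₀ * G.E + cs * p₀ ^ 2 * D ≤ b) (hbA : b < ce * p₀ * A)
    {Nsz : ℕ} (hNsz : 64 ≤ Nsz) {N : ℕ → ℕ} (hN : ∀ i, i ≤ G.E → 1 ≤ N i) {Rmax : ℝ}
    (hR : ∀ i, i ≤ G.E → (N i : ℝ) ≤ Rmax) (Clean : ℕ → ℕ → Prop)
    (hclean : ∀ i, i ≤ G.E → ∀ l, 1 ≤ l → l ≤ G.steps (G.base i) → Clean i l)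
    (hstop : ∀ i, i ≤ G.E → ∀ K, K ≤ G.steps (G.base i) →
      StopAt Nsz (N i) (Clean i) (fun n => Siter (ratio G.L (G.expo (G.base i))) n (G.dom (G.base i))) K →
        G.steps (G.base i) ≤ K) :
    (∑ i ∈ Finset.range (G.E + 1), ((G.steps (G.base i) : ℕ) : ℝ)) <
      A * T4BankAgeYoung.epochAllowance d (T4EpochSize.modelC d) Rmax A := by
  have hN0 : (1 : ℝ) ≤ N 0 := by exact_mod_cast hN 0 (Nat.zero_le _)
  have hRmax : 0 ≤ Rmax := by linarith [hR 0 (Nat.zero_le _)]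
  have hL3 : 3 ≤ G.L := le_trans (by norm_num) hG.four_le
  exact G.lifetime_lt_of_geometric hG h0 hc hd hDD hce hp hP5 hb hbA (R := fun i => (N i : ℝ)) hRmax hR
    fun i hi => horizon hL3 (hG.drop (G.base i)) (hG.dom_nonempty (G.base i)) (hG.dom_conn (G.base i)) hNsz
      (hN i hi) (Clean i) (hclean i hi) le_rfl (hstop i hi)

end SubHistory

/-! ## §3 Non-vacuity (`d = 1`) -/

section NonVacuity

open B16MergeGeometry.OneDim T4GeometricLedger

/-- A one-cube row has linear size `0`. [folklore] -/
theorem treeLen_row_zero (a : ℤ) : treeLen (row a 0) = 0 := by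
  rw [show row a 0 = {pt a} by simp [row]]
  exact treeLen_singleton _

/-- §1 IS INHABITED WITH A GENUINE STOPPING CONSTRAINT: the one-cube base `{0}` on the line, `L = 4`, constant exponents,
horizon `m = 1`, memory `N = 1`, `Nsz = 64`, everything clean, epoch length `len = 1`; the stopping reading holds because
a stopping index is at least the memory (`le_of_stopAt`), and the theorem yields an index `k` (`= 0` or with a cover of
positive size) with `1 ≤ k + 1`. [folklore] -/
example : ∃ k : ℕ, (k = 0 ∨ 0 < T4EpochSize.coverProfile 4 (fun _ => (0 : ℕ)) 1 (row 0 0) k) ∧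
    ((1 : ℕ) : ℝ) ≤ k + ((1 : ℕ) : ℝ) :=
  horizon (le_of_lt (by norm_num)) (fun i k _ _ => by omega) (row_nonempty 0 0) (faceConnected_row 0 0) le_rfl
    le_rfl (fun _ => True) (fun _ _ _ => trivial) le_rfl fun K _ hK => le_of_stopAt hK

/-- THE BOOKED MASS OF THE TEST LEDGER of `…T4GeometricLedger` §4, doubled booking: `Dtot₂ = 2·(0 + 1) + 2·(0 + 1) = 4`
(one founding cube, one born cube, both of linear size `0`). [folklore] -/
theorem geoEx_Dtot₂ : geoEx.toLedger₂.Dtot = 4 := by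
  have hE : geoEx.toLedger₂.E = 1 := rfl
  rw [T4Genealogy.Ledger.Dtot, hE, Finset.sum_range_succ, Finset.sum_range_one, T4Genealogy.Ledger.f_zero,
    geoEx.toLedger₂.f_succ_of_lt (show 0 < geoEx.toLedger₂.E from by rw [hE]; exact Nat.one_pos)]
  simp [GeoLedger.toLedger₂, GeoLedger.toLedger, GeoLedger.bmass, geoEx, treeLen_row_zero]
  norm_num

/-- **§2 APPLIED END TO END**: the hypotheses of `lifetime_lt_of_geometric_stopping` are JOINTLY INHABITED by the test
ledger `geoEx` of `…T4GeometricLedger` §4 (`d = 1`, one founded cube, one event at once — all step counts `0`) with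
`D = 4 = Dtot₂`, `c_e = c_s = p̄₀ = 1`, `b = 5`, `A = 6`, `Nsz = 64`, memories `N ≡ 1 = R_max`, everything clean; the
stopping reading holds trivially for epochs of length `0`, and the theorem's conclusion reads
`Σ_{i ≤ 1} 0 < 6·epochAllowance 1 (modelC 1) 1 6`. [folklore] -/
example : (∑ i ∈ Finset.range (geoEx.E + 1), ((geoEx.steps (geoEx.base i) : ℕ) : ℝ)) <
    ((6 : ℕ) : ℝ) * T4BankAgeYoung.epochAllowance 1 (T4EpochSize.modelC 1) 1 6 :=
  lifetime_lt_of_geometric_stopping geoEx geoEx_geometric (by simp [geoEx])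
    (fun e he => by
      have he0 : e = 0 := by simp only [geoEx] at he; omega
      subst he0
      simp [geoEx, GeoLedger.toLedger])
    le_rfl (D := 4) (A := 6) (by rw [geoEx_Dtot₂]; norm_num) (ce := 1) (cs := 1) (p₀ := 1) (b := 5) one_pos one_pos
    (by norm_num) (by norm_num [geoEx]) (by norm_num) (Nsz := 64) le_rfl (N := fun _ => 1) (fun _ _ => le_rfl)
    (Rmax := 1) (fun _ _ => by norm_num) (fun _ _ => True) (fun _ _ _ _ _ => trivial)
    (fun i _ K _ _ => by simp [geoEx])

end NonVacuity

/-! ## §4 [v1.1] The flow and the young-window forms of Lemma Y, horizon discharged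

[v1.1, APPEND-ONLY — every v1 declaration above is unchanged.]  §2 composed `GeoLedger.lifetime_lt_of_geometric` (the
`R_max` form of Lemma Y).  The two forms the node-U5 closure reads — the FLOW form (windows = the typed (2.5) windows
`R (s i)` of a flow obeying (I.0.20), allowance `windowMax`) and THE LINK (Y3) (lifetime `< youngAllowance ≤ youngWindow`
at the age cut `A = ageCut C′ K`) — are `T4GenealogyLifetime.lifetime_lt_flow_of_ledger` / `lifetime_lt_youngWindow_of_ledger`
on the genealogy ledger with ABSTRACT profiles `d′` and the horizon binder `hlen`.  Here both are composed on the doubled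
booking `toLedger₂` of a `Geometric` `GeoLedger` with the profiles BEING the cover profiles of the epoch bases (`hint` /
`hhalf` discharged by `T4EpochSize.coverProfile_int` / `coverProfile_halving` and `GeoLedger.treeLen_dom_base_le_σ`,
exactly as in `T4GenealogyLifetime.lifetime_lt_of_ledger_cover`) and `hlen` DISCHARGED by §1's `horizon` with the memory
of epoch `i` BEING its window: `N i = R (s i)` (print: «with N = R_j», p. 384 — the memory of the stopping rule is the
(2.5) window of the creation scale; `R (s i) ≥ 1` because a (2.5) window is a power of `L₁ ≥ 1`, `one_le_of_isRj`).
What remains hypothesis: the S-side credits, the flow data of `T4BankAgeYoung.lifetime_lt_flow` verbatim, the size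
parameter `Nsz ≥ 64`, per-epoch cleanliness and the STOPPING READING (§1, NOT CLAIMED (ii)). [folklore] -/

section FlowForms

open T4GeometricLedger

variable {κ ι : Type*}

/-- A (2.5) window is a power `L₁^s` of the scale ratio, hence `≥ 1` when `L₁ ≥ 1`. [folklore] -/
theorem one_le_of_isRj {L₁ r : ℕ} (hL : 1 ≤ L₁) {gj : ℝ} {Rj : ℕ} (h : B14.IsRj L₁ r gj Rj) : 1 ≤ Rj := by
  obtain ⟨s, hs, -⟩ := h
  rw [hs]
  exact Nat.one_le_pow _ _ hL

/-- The cover profiles of the epoch bases of a `Geometric` ledger discharge `hint` and `hhalf` of Lemma Y on the doubled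
booking (as in `T4GenealogyLifetime.lifetime_lt_of_ledger_cover`). [folklore] -/
theorem coverProfile_binders (G : GeoLedger d κ ι) (hG : G.Geometric) :
    (∀ i, i ≤ G.E → ∀ k,
      0 < T4EpochSize.coverProfile G.L (G.expo (G.base i)) (G.steps (G.base i)) (G.dom (G.base i)) k →
        1 ≤ T4EpochSize.coverProfile G.L (G.expo (G.base i)) (G.steps (G.base i)) (G.dom (G.base i)) k) ∧
    (∀ i, i ≤ G.E → ∀ k, 1 < k →
      T4EpochSize.coverProfile G.L (G.expo (G.base i)) (G.steps (G.base i)) (G.dom (G.base i)) k ≤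
        (1 / 2) ^ k * G.toLedger₂.σ i) := by
  refine ⟨fun i _ => T4EpochSize.coverProfile_int _, fun i hi k hk => ?_⟩
  exact (T4EpochSize.coverProfile_halving hG.four_le (hG.drop _) (hG.dom_nonempty _) (hG.dom_conn _) k hk).trans
    (mul_le_mul_of_nonneg_left (G.treeLen_dom_base_le_σ i hi) (by positivity))

variable [DecidableEq κ] [DecidableEq ι]

/-- **LEMMA Y WITH THE FLOW ON A GEOMETRIC GENEALOGY LEDGER, HORIZON DISCHARGED**
(`T4GenealogyLifetime.lifetime_lt_flow_of_ledger` ∘ `coverProfile_binders` ∘ `horizon`): the windows are the typed (2.5)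
windows `R (s i)` at the epochs' start scales `s i ≤ K` of a flow obeying (I.0.20) up to `K` (hypotheses of
`T4BankAgeYoung.lifetime_lt_flow` verbatim), and they ARE the memories of the stopping rule; the total lifetime is
`< A·epochAllowance d (modelC d) (windowMax L₁ r x̄ c̄ K) A`. [folklore] -/
theorem lifetime_lt_flow_of_geometric_stopping (G : GeoLedger d κ ι) (hG : G.Geometric)
    (h0 : G.base₀ ∈ G.founded 0) (hc : ∀ e, e < G.E → G.consumed e ⊆ G.toLedger.alive e) (hd : 1 ≤ d)
    {D A : ℕ} (hDD : G.toLedger₂.Dtot ≤ (D : ℝ))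
    {ce cs p₀ b : ℝ} (hce : 0 < ce) (hp : 0 < p₀) (hP5 : ce ≤ cs * p₀)
    (hb : ce * p₀ * G.E + cs * p₀ ^ 2 * D ≤ b) (hbA : b < ce * p₀ * A)
    (F : Flow) (K : ℕ) {β' : ℝ} (hβ' : 0 ≤ β') {L₁ r : ℕ} (hL : 1 ≤ L₁)
    (hpos : ∀ j, j ≤ K → 0 < F.g j) (hle1 : ∀ j, j ≤ K → F.g j ≤ 1) (hrg : F.SatisfiesRG K)
    (hub : ∀ j, j < K → F.β (j + 1) (F.g j) ≤ β') (R : ℕ → ℕ) (hRj : ∀ j, j ≤ K → B14.IsRj L₁ r (F.g j) (R j))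
    {x c : ℝ} (hx : 0 ≤ x) (hcc : 0 ≤ c) (hxK : Real.log ((F.g K) ^ 2)⁻¹ ≤ x) (hcK : (F.g K) ^ 2 * β' ≤ c)
    {s : ℕ → ℕ} (hs : ∀ i, i ≤ G.E → s i ≤ K)
    {Nsz : ℕ} (hNsz : 64 ≤ Nsz) (Clean : ℕ → ℕ → Prop)
    (hclean : ∀ i, i ≤ G.E → ∀ l, 1 ≤ l → l ≤ G.steps (G.base i) → Clean i l)
    (hstop : ∀ i, i ≤ G.E → ∀ K', K' ≤ G.steps (G.base i) →
      StopAt Nsz (R (s i)) (Clean i) (fun n => Siter (ratio G.L (G.expo (G.base i))) n (G.dom (G.base i))) K' →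
        G.steps (G.base i) ≤ K') :
    (∑ i ∈ Finset.range (G.E + 1), ((G.steps (G.base i) : ℕ) : ℝ)) <
      A * T4BankAgeYoung.epochAllowance d (T4EpochSize.modelC d) (T4BankAgeYoung.windowMax L₁ r x c K) A := by
  have hL3 : 3 ≤ G.L := le_trans (by norm_num) hG.four_le
  obtain ⟨hint, hhalf⟩ := coverProfile_binders G hG
  exact T4GenealogyLifetime.lifetime_lt_flow_of_ledger G.toLedger₂ (G.wf₂_of_geometric hG h0 hc)
    (T4EpochSize.one_le_modelC d) hd (G.hfnd₂_of_geometric hG) (G.hev₂_of_geometric hG) (m := G.E) le_rfl hDD hce hp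
    hP5 hb hbA (len := fun i => G.steps (G.base i)) hint hhalf F K hβ' hL hpos hle1 hrg hub R hRj hx hcc hxK hcK hs
    fun i hi => horizon hL3 (hG.drop (G.base i)) (hG.dom_nonempty _) (hG.dom_conn _) hNsz
      (one_le_of_isRj hL (hRj (s i) (hs i hi))) (Clean i) (hclean i hi) le_rfl (hstop i hi)

/-- **THE LINK (Y3) ON A GEOMETRIC GENEALOGY LEDGER, HORIZON DISCHARGED**
(`T4GenealogyLifetime.lifetime_lt_youngWindow_of_ledger` ∘ `coverProfile_binders` ∘ `horizon`): at the age cut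
`A = ageCut C′ K` the total lifetime is `< youngAllowance d L₁ r (modelC d) C′ x̄ c̄ K ≤ youngWindow … K` — on the
model, a sub-history with a small bank was created within the window the summable young rate allows, the horizon
sentence of p. 385 no longer a binder. [folklore] -/
theorem lifetime_lt_youngWindow_of_geometric_stopping (G : GeoLedger d κ ι) (hG : G.Geometric)
    (h0 : G.base₀ ∈ G.founded 0) (hc : ∀ e, e < G.E → G.consumed e ⊆ G.toLedger.alive e) (hd : 1 ≤ d)
    {D : ℕ} {C' : ℝ} {K : ℕ} (hDD : G.toLedger₂.Dtot ≤ (D : ℝ))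
    {ce cs p₀ b : ℝ} (hce : 0 < ce) (hp : 0 < p₀) (hP5 : ce ≤ cs * p₀)
    (hb : ce * p₀ * G.E + cs * p₀ ^ 2 * D ≤ b) (hbA : b < ce * p₀ * (T4RemnantBooking.ageCut C' K))
    (F : Flow) {β' : ℝ} (hβ' : 0 ≤ β') {L₁ r : ℕ} (hL : 1 ≤ L₁)
    (hpos : ∀ j, j ≤ K → 0 < F.g j) (hle1 : ∀ j, j ≤ K → F.g j ≤ 1) (hrg : F.SatisfiesRG K)
    (hub : ∀ j, j < K → F.β (j + 1) (F.g j) ≤ β') (R : ℕ → ℕ) (hRj : ∀ j, j ≤ K → B14.IsRj L₁ r (F.g j) (R j))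
    {x c : ℝ} (hx : 0 ≤ x) (hcc : 0 ≤ c) (hxK : Real.log ((F.g K) ^ 2)⁻¹ ≤ x) (hcK : (F.g K) ^ 2 * β' ≤ c)
    {s : ℕ → ℕ} (hs : ∀ i, i ≤ G.E → s i ≤ K)
    {Nsz : ℕ} (hNsz : 64 ≤ Nsz) (Clean : ℕ → ℕ → Prop)
    (hclean : ∀ i, i ≤ G.E → ∀ l, 1 ≤ l → l ≤ G.steps (G.base i) → Clean i l)
    (hstop : ∀ i, i ≤ G.E → ∀ K', K' ≤ G.steps (G.base i) →
      StopAt Nsz (R (s i)) (Clean i) (fun n => Siter (ratio G.L (G.expo (G.base i))) n (G.dom (G.base i))) K' →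
        G.steps (G.base i) ≤ K') :
    (∑ i ∈ Finset.range (G.E + 1), ((G.steps (G.base i) : ℕ) : ℝ)) <
        T4BankAgeYoung.youngAllowance d L₁ r (T4EpochSize.modelC d) C' x c K ∧
      (∑ i ∈ Finset.range (G.E + 1), ((G.steps (G.base i) : ℕ) : ℝ)) <
        (T4BankAgeYoung.youngWindow d L₁ r (T4EpochSize.modelC d) C' x c K : ℝ) := by
  have hL3 : 3 ≤ G.L := le_trans (by norm_num) hG.four_le
  obtain ⟨hint, hhalf⟩ := coverProfile_binders G hG
  exact T4GenealogyLifetime.lifetime_lt_youngWindow_of_ledger G.toLedger₂ (G.wf₂_of_geometric hG h0 hc)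
    (T4EpochSize.one_le_modelC d) hd (G.hfnd₂_of_geometric hG) (G.hev₂_of_geometric hG) (m := G.E) le_rfl hDD hce hp
    hP5 hb hbA (len := fun i => G.steps (G.base i)) hint hhalf F hβ' hL hpos hle1 hrg hub R hRj hx hcc hxK hcK hs
    fun i hi => horizon hL3 (hG.drop (G.base i)) (hG.dom_nonempty _) (hG.dom_conn _) hNsz
      (one_le_of_isRj hL (hRj (s i) (hs i hi))) (Clean i) (hclean i hi) le_rfl (hstop i hi)

end FlowForms

/-! ### §4 non-vacuity: the flat one-scale flow -/

section NonVacuityFlow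

open T4GeometricLedger

/-- The (2.5) window of a coupling `g = 1` is `1 = L₁^0` (`log 1 = 0`; any `r ≥ 1`, `L₁ = 1`). [folklore] -/
theorem isRj_one : B14.IsRj 1 1 1 1 :=
  ⟨0, by simp, by simp, fun _ _ => Nat.zero_le _⟩

/-- §4 IS INHABITED (flow form): `lifetime_lt_flow_of_geometric_stopping` APPLIED to the test ledger `geoEx` of
`…T4GeometricLedger` §4 with the FLAT FLOW `g ≡ 1`, `β ≡ 0` on the one-scale horizon `K = 0` (start scales `s ≡ 0`,
windows `R ≡ 1`, `β′ = x̄ = c̄ = 0`, `L₁ = r = 1`), S-side data as in §3 (`D = 4`, `b = 5`, `A = 6`), `Nsz = 64`,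
everything clean; conclusion `Σ_{i ≤ 1} 0 < 6·epochAllowance 1 (modelC 1) (windowMax 1 1 0 0 0) 6`. (The (Y3) form's cut
`ageCut C′ 0 = 0` makes `K = 0` uninhabitable; its inhabitation at `K ≥ 1` is a numerical `log` bound, not exercised.)
[folklore] -/
example : (∑ i ∈ Finset.range (geoEx.E + 1), ((geoEx.steps (geoEx.base i) : ℕ) : ℝ)) <
    ((6 : ℕ) : ℝ) * T4BankAgeYoung.epochAllowance 1 (T4EpochSize.modelC 1) (T4BankAgeYoung.windowMax 1 1 0 0 0) 6 :=
  lifetime_lt_flow_of_geometric_stopping geoEx geoEx_geometric (by simp [geoEx])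
    (fun e he => by
      have he0 : e = 0 := by simp only [geoEx] at he; omega
      subst he0
      simp [geoEx, GeoLedger.toLedger])
    le_rfl (D := 4) (A := 6) (by rw [geoEx_Dtot₂]; norm_num) (ce := 1) (cs := 1) (p₀ := 1) (b := 5) one_pos one_pos
    (by norm_num) (by norm_num [geoEx]) (by norm_num) ⟨fun _ => 1, fun _ _ => 0⟩ 0 (β' := 0) le_rfl (L₁ := 1) (r := 1)
    le_rfl (fun _ _ => one_pos) (fun _ _ => le_rfl) (fun k hk => absurd hk (Nat.not_lt_zero k))
    (fun j hj => absurd hj (Nat.not_lt_zero j)) (fun _ => 1) (fun _ _ => isRj_one) (x := 0) (c := 0) le_rfl le_rfl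
    (by simp) (by simp) (s := fun _ => 0) (fun _ _ => le_rfl) (Nsz := 64) le_rfl (fun _ _ => True)
    (fun _ _ _ _ _ => trivial) (fun i _ K' _ _ => by simp [geoEx])

end NonVacuityFlow

end

end Literature.MathematicalPhysics.QuantumFieldTheory.Balaban1983to89.T4EpochHorizon
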